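import Summits.BirchSwinnertonDyer.Rank1Residual.ManinAdditive.HalfTranslateTwistStep
import HarnessLib

/-!
# THEOREM A EXACT at `2` — FILE 2/4 of T-an-7 (`TwistOrbitManinTransportAtTwoExact`): the landed conjecture
# schema `TwistOrbitManinTransport` of `TwistOrbitManinStatements.lean` CLOSED at `(−1, 2, M)` (`16 ∣ M`) and
# `(±2, 2, M)` (`64 ∣ M`), hence THEOREM II `FlipOrbitManinEq` EXACT at `2` and THEOREM III `OrbitManinDefectLeOne`
# at `2` modulo Pal's dichotomy; degree-road consequences modulo ČNS Thm 1.2 only (§18)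

PROVENANCE. Cell `bsd-f2-manin`, planner `bsd-f2-manin-an` g4: §18 of the kernel-checked HOME/an/Sketch-an5v3.lean
7cd536ef1a662bfb, landed VERBATIM by the cell's typer (T-an-7, file 2/4; file 1/4 = `HalfTranslateTwistStep`, whose
module docstring has the full provenance and the mathematics of S-an-9).  PROVED theorems only, no `sorry`, no
conjecture tags; the printed inputs ČNS Thm 1.2 (`cesnaviciusNeururerSaha_thm_1_2`) and Pal's dichotomy
(`PalTwistDichotomy`) enter only as explicit hypotheses where stated.

CONTENT (§18).  `twistOrbitManinTransport_two_of_char` (generic in the character data: primitive quadratic `χ` mod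
`2k`, `χ(even) = 0`, `g(χ)² = 4d`, `aₙ(X ⊗ d) = χ(n)aₙ(X)` for odd `n`, and the HALF-TRANSLATE collapse of Birch's
sum) ⇒ `TwistOrbitManinTransport d 2 M` for `(2k)² ∣ M`: clause `ũ = 1`: `c′ ∣ c`; clause `ũ = 2`: `c′ ∣ 2c`
(g3's T-an-6b add-on had `2c` / `4c`).  Instances `twistOrbitManinTransport_negOne_two (16 ∣ M)`, `_two_two`,
`_negTwo_two (64 ∣ M)` and the three closed ones `(−1,2,16)`, `(2,2,64)`, `(−2,2,64)`; the landed edges give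
`flipOrbitManinEq_*_two` (THM II: `v_ℓ(c) = v_ℓ(c′)` for EVERY `ℓ` incl. `2`), `orbitManinDefectLeOne_*_two
(hP : PalTwistDichotomy d 2 M)`, `twistPartnerDegreeBound_*_two (hCNS)`.  BC5 (Cremona `N < 5·10⁵`): χ₋₄ same-level
orbits `2⁵ ∣ N` 148 277 / 148 277, χ±8 commuting 28 112 (ratio 2), flips 742 / 742 (ratio 1); falsifiers 0
(HOME/MEMO-an.md §40).
References: [cite: Stevens1989, Lemma (5.4) p. 97] [cite: Pal2012, Lemma 3.1] [cite: SilvermanATAEC1994, Cor. IV.9.1]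
[cite: CesnaviciusNeururerSaha2023, Thm. 1.2].
-/

noncomputable section

open scoped MatrixGroups ModularForm

open CongruenceSubgroup WeierstrassCurve
  Literature.NumberTheory.DiophantineGeometry
  Literature.NumberTheory.EllipticCurves
  Literature.NumberTheory.EllipticCurves.ModularForms

namespace Summit.BirchSwinnertonDyer.Rank1Residual.ManinAdditive

section ThmAExactAtTwo

/-! ## §18 THEOREM A EXACT at `2`: `TwistOrbitManinTransport (−1) 2 M` (`16 ∣ M`), `(±2) 2 M` (`64 ∣ M`) -/

/-- **E-an-9 at `q = 2` is a THEOREM (generic form).** For a primitive quadratic character `χ` mod `2k`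
with `χ(even) = 0`, `g(χ)² = 4d`, `aₙ(X ⊗ d) = χ(n)aₙ(X)` for odd `n`, `4² ∣ (2k)²`, and the HALF-TRANSLATE
collapse of Birch's character sum (§16): `TwistOrbitManinTransport d 2 M` for every `M` with `(2k)² ∣ M`
— clause `ũ = 1`: `c′ ∣ c`; clause `ũ = 2`: `c′ ∣ 2c`.  Chain: `z = c′w ∈ Λ_{W′}`, `w ∈ Λ(f_W ⊗ χ)`,
`(g/2) w ∈ Λ(f_W)` (§16), `c (g/2) w ∈ Λ_W`, `Λ_C = ũ (g/2)⁻¹ Λ_W` (§17) ⟹ `(ũ c/c′) Λ_{W′} ⊆ Λ_C`.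
[cite: Stevens1989, Lemma (5.4)] [cite: Pal2012, Lemma 3.1] [cite: SilvermanATAEC1994, Cor. IV.9.1] -/
theorem twistOrbitManinTransport_two_of_char {d : ℤ} (hd : d ≠ 0) {k : ℕ} [NeZero k]
    (h16 : 4 ^ 2 ∣ (2 * k) ^ 2)
    {χ : DirichletCharacter ℂ (2 * k)} (hχ : χ.IsQuadratic) (hprim : χ.IsPrimitive)
    (hG : gaussSum χ (ZMod.stdAddChar (N := 2 * k)) ^ 2 = 4 * ((d : ℤ) : ℂ))
    (hodd : ∀ (X : WeierstrassCurve ℚ) [X.IsElliptic] (n : ℕ), ¬ 2 ∣ n →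
      (((X.quadraticTwist ((d : ℤ) : ℚ)).LFunction n : ℤ) : ℂ) = χ n * (X.LFunction n : ℂ))
    (heven : ∀ n : ℕ, 2 ∣ n → χ n = 0)
    (hsumOf : ∀ {N : ℕ} [NeZero N] (f : CuspForm (Gamma0 N) 2),
      (∀ x : ℚ, modularSymbol f (x + 1 / 2) = -modularSymbol f x) →
      ∀ x : ℚ, ∃ (u₁ u₂ : ZMod (2 * k)) (ε : ℤ),
        ∑ u : ZMod (2 * k), χ u * modularSymbol f (x + twistShift u) =
          2 * (modularSymbol f (x + twistShift u₁) + ε * modularSymbol f (x + twistShift u₂)))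
    {M : ℕ} (hMk : (2 * k) ^ 2 ∣ M) : TwistOrbitManinTransport d 2 M := by
  intro W W' C _ _ _ _ _ _ _ _ u D D' hM hN hu hiso hD'
  haveI : Fact (Nat.Prime 2) := ⟨Nat.prime_two⟩
  haveI : NeZero (2 * k) := ⟨mul_ne_zero two_ne_zero (NeZero.ne k)⟩
  have hd0 : ((d : ℤ) : ℚ) ≠ 0 := by exact_mod_cast hd
  have hMW : (2 * k) ^ 2 ∣ W.conductorNorm ℤ := hMk.trans hM
  have hM' : (2 * k) ^ 2 ∣ W'.conductorNorm ℤ := by rw [hN]; exact hMW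
  have h4 : 2 ^ 2 ∣ W.conductorNorm ℤ := dvd_trans (pow_dvd_pow_of_dvd (dvd_mul_right 2 k) 2) hMW
  have h4' : 2 ^ 2 ∣ W'.conductorNorm ℤ := dvd_trans (pow_dvd_pow_of_dvd (dvd_mul_right 2 k) 2) hM'
  obtain ⟨hngW, hnmW⟩ := not_good_and_not_mult_of_sq_dvd_conductorNorm W h4
  obtain ⟨hngW', hnmW'⟩ := not_good_and_not_mult_of_sq_dvd_conductorNorm W' h4'
  have hW0 : ∀ n : ℕ, 2 ∣ n → W.LFunction n = 0 := fun n hn ↦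
    W.LFunction_apply_eq_zero_of_not_good_of_not_mult 2 hngW hnmW hn
  have hW'0 : ∀ n : ℕ, 2 ∣ n → W'.LFunction n = 0 := fun n hn ↦
    W'.LFunction_apply_eq_zero_of_not_good_of_not_mult 2 hngW' hnmW' hn
  have hs : (gaussSum χ (ZMod.stdAddChar (N := 2 * k)) / 2) ^ 2 = ((((d : ℤ) : ℚ)) : ℂ) := by
    rw [div_pow, hG]; push_cast; ring
  have hcoef := fun n ↦
    cuspCoeff_eq_chi_mul_of_twist_even hd0 u hu hiso.LFunction_eq (hodd W) heven hW'0 D D' n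
  have hevenD : ∀ n : ℕ, 2 ∣ n → cuspCoeff D.f n = 0 := fun n hn ↦ by
    rw [D.isNewformOf.2 n, hW0 n hn, Int.cast_zero]
  have hhalf : ∀ x : ℚ, modularSymbol D.f (x + 1 / 2) = -modularSymbol D.f x :=
    modularSymbol_add_half_eq_neg D.f (h16.trans hMW) hevenD
  haveI : (C.baseChange ℂ).IsElliptic := by rw [WeierstrassCurve.baseChange]; infer_instance
  obtain ⟨LC, hLC⟩ := exists_isNeronLatticeOf_holds (C.baseChange ℂ)
  have hNdvd : W.conductorNorm ℤ ∣ W'.conductorNorm ℤ := by rw [hN]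
  have hstep : ∀ w ∈ periodLattice (charTwist (W'.conductorNorm ℤ) hNdvd hM' hχ D.f),
      gaussSum χ (ZMod.stdAddChar (N := 2 * k)) / 2 * w ∈ periodLattice D.f := fun w hw ↦
    half_gaussSum_mul_mem_periodLattice_of_mem_charTwist _ hNdvd hM' hχ hprim D.f (hsumOf D.f hhalf) hw
  refine ⟨fun hΔ ↦ ?_, fun hΔ ↦ ?_⟩
  · have hΔ1 : (1 : ℚ) ^ 12 * C.Δ = ((d : ℤ) : ℚ) ^ 6 * W.Δ := by rw [one_pow, one_mul]; exact hΔ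
    have hmem : ∀ z : ℂ, gaussSum χ (ZMod.stdAddChar (N := 2 * k)) / 2 * z ∈ D.L.lattice →
        ((1 : ℤ) : ℂ) * z ∈ LC.lattice := fun z hz ↦ by
      rw [neronLattice_mem_iff_of_twist_of_sq_eq hd0 u hu hΔ1 hs D.isNeronLattice hLC]
      convert hz using 2
      push_cast
      ring
    simpa using
      maninConstant_dvd_mul_of_twistStep D D' hD' hχ hprim hNdvd hM' hcoef _ hstep hLC 1 hmem
  · have hΔq : ((2 : ℕ) : ℚ) ^ 12 * C.Δ = ((d : ℤ) : ℚ) ^ 6 * W.Δ := hΔ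
    have hmem : ∀ z : ℂ, gaussSum χ (ZMod.stdAddChar (N := 2 * k)) / 2 * z ∈ D.L.lattice →
        ((2 : ℤ) : ℂ) * z ∈ LC.lattice := fun z hz ↦ by
      rw [neronLattice_mem_iff_of_twist_of_sq_eq hd0 u hu hΔq hs D.isNeronLattice hLC]
      convert hz using 2
      push_cast
      ring
    exact_mod_cast
      maninConstant_dvd_mul_of_twistStep D D' hD' hχ hprim hNdvd hM' hcoef _ hstep hLC 2 hmem

/-- **THEOREM A EXACT at `χ₋₄`: `TwistOrbitManinTransport (−1) 2 M` for every `M` with `16 ∣ M`** —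
on a same-level `χ₋₄`-orbit with `16 ∣ N`, `c(optimal partner) ∣ ũ · c(twist-minimal member)`,
`ũ ∈ {1, 2}` (no factor `η`). [cite: Stevens1989, Lemma (5.4)] [cite: Pal2012, Lemma 3.1] -/
theorem twistOrbitManinTransport_negOne_two {M : ℕ} (hM : 16 ∣ M) : TwistOrbitManinTransport (-1) 2 M := by
  haveI : NeZero (2 : ℕ) := ⟨by norm_num⟩
  refine twistOrbitManinTransport_two_of_char (k := 2) (by norm_num) (by norm_num)
    isQuadratic_χ₄_ringHomComp isPrimitive_χ₄_ringHomComp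
    (by rw [gaussSum_χ₄_ringHomComp_sq]; push_cast; ring) (fun X _ n hn ↦ ?_) (fun n hn ↦ ?_)
    (fun f hhalf x ↦ ⟨1, 3, 0, sum_χ₄_modularSymbol_of_half f hhalf x⟩) (by simpa using hM)
  · rw [show ((-1 : ℤ) : ℚ) = -1 by norm_num, X.LFunction_quadraticTwist_neg_one_apply_of_odd hn,
      Int.cast_mul, χ₄_ringHomComp_apply_natCast]
  · rw [χ₄_ringHomComp_apply_natCast, ZMod.χ₄_nat_eq_if_mod_four, if_pos (Nat.mod_eq_zero_of_dvd hn)]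
    simp

/-- **THEOREM A EXACT at `χ₈`: `TwistOrbitManinTransport 2 2 M` for every `M` with `64 ∣ M`.**
[cite: Stevens1989, Lemma (5.4)] [cite: Pal2012, Lemma 3.1] -/
theorem twistOrbitManinTransport_two_two {M : ℕ} (hM : 64 ∣ M) : TwistOrbitManinTransport 2 2 M := by
  haveI : NeZero (4 : ℕ) := ⟨by norm_num⟩
  refine twistOrbitManinTransport_two_of_char (k := 4) (by norm_num) (by norm_num)
    isQuadratic_χ₈_ringHomComp isPrimitive_χ₈_ringHomComp
    (by rw [gaussSum_χ₈_ringHomComp_sq]; push_cast; ring) (fun X _ n hn ↦ ?_) (fun n hn ↦ ?_)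
    (fun f hhalf x ↦ ⟨1, 3, -1, sum_χ₈_modularSymbol_of_half f hhalf x⟩) (by simpa using hM)
  · rw [show ((2 : ℤ) : ℚ) = 2 by norm_num, X.LFunction_quadraticTwist_two_apply_of_odd hn,
      Int.cast_mul, χ₈_ringHomComp_apply_natCast]
  · rw [χ₈_ringHomComp_apply_natCast, ZMod.χ₈_nat_eq_if_mod_eight, if_pos (Nat.mod_eq_zero_of_dvd hn)]
    simp

/-- **THEOREM A EXACT at `χ₋₈`: `TwistOrbitManinTransport (−2) 2 M` for every `M` with `64 ∣ M`.**
[cite: Stevens1989, Lemma (5.4)] [cite: Pal2012, Lemma 3.1] -/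
theorem twistOrbitManinTransport_negTwo_two {M : ℕ} (hM : 64 ∣ M) :
    TwistOrbitManinTransport (-2) 2 M := by
  haveI : NeZero (4 : ℕ) := ⟨by norm_num⟩
  refine twistOrbitManinTransport_two_of_char (k := 4) (by norm_num) (by norm_num)
    isQuadratic_χ₈'_ringHomComp isPrimitive_χ₈'_ringHomComp
    (by rw [gaussSum_χ₈'_ringHomComp_sq]; push_cast; ring) (fun X _ n hn ↦ ?_) (fun n hn ↦ ?_)
    (fun f hhalf x ↦ ⟨1, 3, 1, sum_χ₈'_modularSymbol_of_half f hhalf x⟩) (by simpa using hM)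
  · rw [show ((-2 : ℤ) : ℚ) = -2 by norm_num, X.LFunction_quadraticTwist_neg_two_apply_of_odd hn,
      Int.cast_mul, χ₈'_ringHomComp_apply_natCast]
  · rw [χ₈'_ringHomComp_apply_natCast, ZMod.χ₈'_nat_eq_if_mod_eight, if_pos (Nat.mod_eq_zero_of_dvd hn)]
    simp

/-- The three landed instances of the cell's conjecture schema at `q = 2`. -/
theorem twistOrbitManinTransport_negOne_two_sixteen : TwistOrbitManinTransport (-1) 2 16 :=
  twistOrbitManinTransport_negOne_two dvd_rfl

/-- The landed schema instance `TwistOrbitManinTransport 2 2 64` (hypothesis-free). -/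
theorem twistOrbitManinTransport_two_two_sixtyFour : TwistOrbitManinTransport 2 2 64 :=
  twistOrbitManinTransport_two_two dvd_rfl

/-- The landed schema instance `TwistOrbitManinTransport (−2) 2 64` (hypothesis-free). -/
theorem twistOrbitManinTransport_negTwo_two_sixtyFour : TwistOrbitManinTransport (-2) 2 64 :=
  twistOrbitManinTransport_negTwo_two dvd_rfl

/-- **THEOREM II EXACT at `2` (E-an-18v made exact): `FlipOrbitManinEq d 2 M`** — on a flip orbit
(both members twist-minimal, both data lattice-optimal) `v_ℓ(c) = v_ℓ(c′)` for EVERY prime `ℓ`, in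
particular `v₂(c) = v₂(c′)` (g3 had only `|v₂(c) − v₂(c′)| ≤ 1`). Landed edge `flipOrbitManinEq_of_transport`. -/
theorem flipOrbitManinEq_negOne_two {M : ℕ} (hM : 16 ∣ M) : FlipOrbitManinEq (-1) 2 M :=
  flipOrbitManinEq_of_transport (-1) 2 M (twistOrbitManinTransport_negOne_two hM)

/-- THEOREM II EXACT at `χ₈`: `FlipOrbitManinEq 2 2 M` for `64 ∣ M`. -/
theorem flipOrbitManinEq_two_two {M : ℕ} (hM : 64 ∣ M) : FlipOrbitManinEq 2 2 M :=
  flipOrbitManinEq_of_transport 2 2 M (twistOrbitManinTransport_two_two hM)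

/-- THEOREM II EXACT at `χ₋₈`: `FlipOrbitManinEq (−2) 2 M` for `64 ∣ M`. -/
theorem flipOrbitManinEq_negTwo_two {M : ℕ} (hM : 64 ∣ M) : FlipOrbitManinEq (-2) 2 M :=
  flipOrbitManinEq_of_transport (-2) 2 M (twistOrbitManinTransport_negTwo_two hM)

/-- **THEOREM III at `2` modulo twist-minimality only: `PalTwistDichotomy d 2 M → OrbitManinDefectLeOne d 2 M`**
(`c′ ∣ c ∣ 2c′` on any same-level orbit at `2` whose `ũ ∈ {1, 2}`). Landed edge
`orbitManinDefectLeOne_of_transport`. -/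
theorem orbitManinDefectLeOne_negOne_two {M : ℕ} (hM : 16 ∣ M) (hP : PalTwistDichotomy (-1) 2 M) :
    OrbitManinDefectLeOne (-1) 2 M :=
  orbitManinDefectLeOne_of_transport (-1) 2 M (twistOrbitManinTransport_negOne_two hM) hP

/-- THEOREM III at `χ₈` modulo Pal's dichotomy (`64 ∣ M`). -/
theorem orbitManinDefectLeOne_two_two {M : ℕ} (hM : 64 ∣ M) (hP : PalTwistDichotomy 2 2 M) :
    OrbitManinDefectLeOne 2 2 M :=
  orbitManinDefectLeOne_of_transport 2 2 M (twistOrbitManinTransport_two_two hM) hP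

/-- THEOREM III at `χ₋₈` modulo Pal's dichotomy (`64 ∣ M`). -/
theorem orbitManinDefectLeOne_negTwo_two {M : ℕ} (hM : 64 ∣ M) (hP : PalTwistDichotomy (-2) 2 M) :
    OrbitManinDefectLeOne (-2) 2 M :=
  orbitManinDefectLeOne_of_transport (-2) 2 M (twistOrbitManinTransport_negTwo_two hM) hP

/-- The degree-road consequences at `2` modulo the printed ČNS Thm 1.2 ONLY (landed edge
`twistPartnerDegreeBound_of_transport`; `cesnaviciusNeururerSaha_thm_1_2` is a named Literature fact). -/
theorem twistPartnerDegreeBound_negOne_two {M : ℕ} (hM : 16 ∣ M) (hCNS : cesnaviciusNeururerSaha_thm_1_2) :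
    TwistPartnerDegreeBound (-1) M :=
  twistPartnerDegreeBound_of_transport (-1) 2 M (twistOrbitManinTransport_negOne_two hM) hCNS

/-- E-an-15v at `χ₈` modulo ČNS Thm 1.2 (`64 ∣ M`). -/
theorem twistPartnerDegreeBound_two_two {M : ℕ} (hM : 64 ∣ M) (hCNS : cesnaviciusNeururerSaha_thm_1_2) :
    TwistPartnerDegreeBound 2 M :=
  twistPartnerDegreeBound_of_transport 2 2 M (twistOrbitManinTransport_two_two hM) hCNS

/-- E-an-15v at `χ₋₈` modulo ČNS Thm 1.2 (`64 ∣ M`). -/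
theorem twistPartnerDegreeBound_negTwo_two {M : ℕ} (hM : 64 ∣ M) (hCNS : cesnaviciusNeururerSaha_thm_1_2) :
    TwistPartnerDegreeBound (-2) M :=
  twistPartnerDegreeBound_of_transport (-2) 2 M (twistOrbitManinTransport_negTwo_two hM) hCNS

end ThmAExactAtTwo

end Summit.BirchSwinnertonDyer.Rank1Residual.ManinAdditive
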